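import Summits.Ventures.PercRepro.C041BlockMapClosure
import Summits.Ventures.PercRepro.C041ZoneEmb

/-!
# ROW C-041 — THE BLOCK MAP ALONG ZONE EMBEDDINGS: stray-vertex invariance of the block map and of the cone
hosts (p6, gen 36)

Setting of `C041BlockMapTransport` (isomorphic hosts) and `C041ZoneEmb` (zone embeddings: an injective map of
the vertices with bijections of the edges and of the terminal edges commuting with the end maps; the vertices
outside the image are isolated).  A zone embedding `φ : ZoneEmb Z₁ Z₂` carries every monochromatic path between
image vertices (`reflTransGen_emb_iff`, from `ZoneEmb.reflTransGen_map` / `ZoneEmb.reflTransGen_of_map`: a path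
of `Z₂` from an image vertex never leaves the image), hence the merged and reached statuses (`Mg_emb`, `Rd_emb`),
the merged set and the blocks of a family of exits (`merged_emb`, `blocks_emb`), the colouring terms
(`colTerm_emb`) and **the block map** (`blockMap_emb`: `blockMap Z₂ (φ.v ∘ u) (φ.v a₁) w = blockMap Z₁ u a₁ w`).
Consequently a host is a cone host iff its image under an embedding is (`coneHost_emb`, `coneHost_of_emb`): the
STRAY vertex left behind by the wedge and the hang of two hosts (`inr a₂`, isolated and unmarked) can be removed —
this is what lets the surgery closure of `C041BlockMapClosure` produce hosts on the nose (the loopified triangles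
of `C041BlockMapTriangleHosts`).  `coneHost_reindex` is the re-indexing of the exits at the level of cone hosts.
-/

namespace PercRepro

namespace ZoneZ

namespace MultiExit

open ZoneData Pendant Finset TwoExit TreeClosure

section Emb

variable {V₁ E₁ U₁ W₁ V₂ E₂ U₂ W₂ : Type} {Z₁ : ZoneData V₁ E₁ U₁ W₁} {Z₂ : ZoneData V₂ E₂ U₂ W₂}
  (φ : ZoneEmb Z₁ Z₂)

/-! ## Monochromatic paths along an embedding -/

/-- The colouring of the embedded state: the transported colouring. -/
theorem state_fst_eq (ω : E₁ → Bool) (m₁ : U₁ → Bool) (m₂ : W₁ → Bool) :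
    (φ.state (ω, m₁, m₂)).1 = ω ∘ φ.e.symm := by
  funext e₂
  have h := φ.state_fst (ω, m₁, m₂) (φ.e.symm e₂)
  rw [Equiv.apply_symm_apply] at h
  exact h

/-- A monochromatic path between image vertices is carried by the embedding: a path of `Z₂` from an image
vertex stays in the image and comes from a path of `Z₁`. -/
theorem reflTransGen_emb_iff (c : Bool) (ω : E₁ → Bool) (x y : V₁) :
    Relation.ReflTransGen (cAdj Z₂ c (ω ∘ φ.e.symm)) (φ.v x) (φ.v y) ↔
      Relation.ReflTransGen (cAdj Z₁ c ω) x y := by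
  let σ : State E₁ U₁ W₁ := (ω, fun _ => false, fun _ => false)
  have h₁ : cAdj Z₁ c ω = Z₁.Adj (fun _ b => b = c) σ := rfl
  have h₂ : cAdj Z₂ c (ω ∘ φ.e.symm) = Z₂.Adj (fun _ b => b = c) (φ.state σ) := by
    funext x y
    show (∃ e, Z₂.Joins e x y ∧ (ω ∘ φ.e.symm) e = c) = ∃ e, Z₂.Joins e x y ∧ (φ.state σ).1 e = c
    rw [state_fst_eq]
  rw [h₁, h₂]
  constructor
  · intro h
    obtain ⟨w, hw, hw'⟩ := φ.reflTransGen_of_map c σ h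
    rw [φ.inj hw]
    exact hw'
  · exact φ.reflTransGen_map c σ

/-- Merged status carried by the embedding. -/
theorem Mg_emb (ω : E₁ → Bool) (x y : V₁) : Z₂.Mg (φ.v x) (φ.v y) (ω ∘ φ.e.symm) ↔ Z₁.Mg x y ω := by
  rw [Mg_iff_reflTransGen, Mg_iff_reflTransGen]
  exact reflTransGen_emb_iff φ false ω x y

/-- Reached status carried by the embedding. -/
theorem Rd_emb (ω : E₁ → Bool) (x y : V₁) : Z₂.Rd (φ.v x) (φ.v y) (ω ∘ φ.e.symm) ↔ Z₁.Rd x y ω := by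
  rw [Rd_iff_reflTransGen, Rd_iff_reflTransGen]
  exact reflTransGen_emb_iff φ true ω x y

/-! ## The statuses of a family of exits -/

variable {ι : Type} (u : ι → V₁) (a₁ : V₁) [Fintype ι] (ω : E₁ → Bool)

/-- The merged set carried by the embedding. -/
theorem merged_emb : merged Z₂ (φ.v ∘ u) (φ.v a₁) (ω ∘ φ.e.symm) = merged Z₁ u a₁ ω := by
  ext k
  rw [mem_merged, mem_merged, Function.comp_apply, Mg_emb φ]

/-- The blocks carried by the embedding. -/
theorem blk_emb : blk Z₂ (φ.v ∘ u) (φ.v a₁) (ω ∘ φ.e.symm) = blk Z₁ u a₁ ω := by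
  funext k
  ext l
  rw [mem_blk, mem_blk, Function.comp_apply, Function.comp_apply, Mg_emb φ, Mg_emb φ]

/-- The blocks carried by the embedding. -/
theorem blocks_emb : blocks Z₂ (φ.v ∘ u) (φ.v a₁) (ω ∘ φ.e.symm) = blocks Z₁ u a₁ ω := by
  ext B
  rw [mem_blocks, mem_blocks]
  simp only [Function.comp_apply, Mg_emb φ, blk_emb φ]

/-- The colouring term carried by the embedding. -/
theorem colTerm_emb (w : ι → Vec6) :
    colTerm Z₂ (φ.v ∘ u) (φ.v a₁) (ω ∘ φ.e.symm) w = colTerm Z₁ u a₁ ω w := by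
  unfold colTerm
  rw [merged_emb φ, blocks_emb φ]
  simp only [Function.comp_apply, Rd_emb φ]

variable [Fintype E₁] [DecidableEq E₁] [Fintype E₂] [DecidableEq E₂]

/-- **The block map is invariant under embeddings of hosts**: the stray vertices outside the image change
nothing. -/
theorem blockMap_emb (w : ι → Vec6) : blockMap Z₂ (φ.v ∘ u) (φ.v a₁) w = blockMap Z₁ u a₁ w := by
  rw [blockMap_eq_sum_colTerm, blockMap_eq_sum_colTerm,
    ← Fintype.sum_equiv (Equiv.arrowCongr φ.e (Equiv.refl Bool))
      (fun ω₁ => colTerm Z₂ (φ.v ∘ u) (φ.v a₁) ((Equiv.arrowCongr φ.e (Equiv.refl Bool)) ω₁) w) _ (fun _ => rfl)]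
  refine Finset.sum_congr rfl fun ω _ => ?_
  have h : (Equiv.arrowCongr φ.e (Equiv.refl Bool)) ω = ω ∘ φ.e.symm := by
    funext e
    rw [Equiv.arrowCongr_apply, Function.comp_apply, Function.comp_apply, Equiv.refl_apply]
  rw [h]
  exact colTerm_emb φ u a₁ ω w

/-! ## Cone hosts along an embedding -/

/-- A cone host embeds into a cone host. -/
theorem coneHost_emb (h : ConeHost Z₁ u a₁) : ConeHost Z₂ (φ.v ∘ u) (φ.v a₁) := by
  intro w hw
  rw [blockMap_emb φ]
  exact h w hw

/-- **A host is a cone host when its image under an embedding is**: the exits and the anchor of the big host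
are the images of those of the small one. -/
theorem coneHost_of_emb {u₂ : ι → V₂} {a₂ : V₂} (hu : ∀ k, u₂ k = φ.v (u k)) (ha : a₂ = φ.v a₁)
    (h : ConeHost Z₂ u₂ a₂) : ConeHost Z₁ u a₁ := by
  intro w hw
  have hu' : u₂ = φ.v ∘ u := funext hu
  rw [hu', ha] at h
  rw [← blockMap_emb φ]
  exact h w hw

end Emb

/-! ## Re-indexing the exits of a cone host -/

/-- A cone host stays a cone host when its exits are re-indexed along an equivalence. -/
theorem coneHost_reindex {ι ι' V₁ E₁ U₁ U₂ : Type} {Z₁ : ZoneData V₁ E₁ U₁ U₂} {u : ι → V₁} {a₁ : V₁}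
    [Fintype ι] [Fintype ι'] [Fintype E₁] [DecidableEq E₁] (e : ι' ≃ ι) (h : ConeHost Z₁ u a₁) :
    ConeHost Z₁ (u ∘ e) a₁ := by
  intro w hw
  have hwe : w = (w ∘ e.symm) ∘ e := by
    funext k
    simp only [Function.comp_apply, Equiv.symm_apply_apply]
  rw [hwe, blockMap_reindex]
  exact h _ fun k => hw (e.symm k)

end MultiExit

end ZoneZ

end PercRepro
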